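import Mathlib
import Literature.Computability.AlgebraicComplexity.FixedPointLog
import Summits.RiemannHypothesis.RiemannHypothesis.Theorems.WeilFormatCJointShiftCert
import HarnessLib

/-!
# Format C: kernel checker of a CELL-REFINED joint-phantom shift certificate (route K3)

Helper file (`--supports stmt-RiemannHypothesis-0098`, lead-track anchor; infrastructure for the Weil-positivity
window ladder, format C far bound), RH-free.  Seat rh-explicit-weil-1 gen3 (memo
`run/shared/lean/pub/rh-explicit/rh-explicit-weil-1/WEIL1-SIZELAW.md` §7).

THE OBJECT.  The torus-SOS certificate of `WeilFormatCJointShiftCert.lean` (route K2) bounds the prime form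
`Σ_n 2Λ(n)/√n · I_f(log n)` on the window `[−a, a]` using only `I_f(u) = 0` for `|u| > 2a`.  Route K3 splits the
window into `p` CELLS of width `2h = 2a/p` and the function into its pieces `f_k = f·1_{cell k}`; the piece
correlations `J_{kl}(u) = ∫ f_k(x − u) f_l(x) dx` vanish as soon as `|u − 2h(l − k)| ≥ 2h` — many more vanishing
classes — and `I_f = Σ_{k,l} J_{kl}`.  A certificate is a family of integer Gram VECTORS `c_{β,k} ∈ ℤ^r` indexed by
(monomial `S_β ∈ ℤ⁴`, cell `k`), so that `Q = (⟨c_i, c_{i'}⟩)/4^kbits ⪰ 0` by construction, found off-line by an SDP.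
Grouping the Gram pairs by the canonical class of `(S_β − S_α, l, k)` under `(γ, k, l) ∼ (−γ, l, k)`
(`J_{kl}(−u) = J_{lk}(u)`) gives, for every real bounded measurable `f` vanishing off `[−aQ, aQ]`,
`Σ_n 2Λ(n)/√n · I_f(log n) ≤ D · ∫ f²` with `D = g₀ + Σ_{classes c ≠ zero, ¬adm} |t(c) + g(c)|`, `g₀ ≥` every
zero-class mass `g(0,k,k)` (soundness: `WeilFormatCCellShiftCertSound.lean`).  `p = 1` is route K2.

THE CHECKER (pure first-order `ℕ/ℤ/ℚ/List` code for `decide +kernel`), a copy of `JointSOS.Cert` with a cell index: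
`Cert.check` (structure, the CLAIMED log enclosures against the tree's `FixedPoint.logNatLo/Hi`, square roots by
squaring, `g₀ + Σ dparts ≤ D`) and `Cert.checkPart k` (upper-triangular pair pass restricted to the classes of part
`k`, admissibility `|γ·ℓ − 2h(l−k)| > 2h` by certified integer comparison, class table by linear search, certified
class bounds with rational weight brackets; the diagonal Gram masses per cell against `g₀`).
-/

set_option linter.dupNamespace false

namespace Summit.RiemannHypothesis.RiemannHypothesis.Theorems.WeilFormatC

namespace CellSOS

open JointSOS

/-- Window items `(j, e, ⌊2^P √(p_j^e)⌋)` as in route K2. [folklore] -/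
abbrev WItem := JointSOS.Cert.WItem

/-- A class key: canonical frequency vector `γ` and the two cells `(k, l)`; it stands for
`J_{kl}(γ·ℓ) = ∫ f_k(x − γ·ℓ) f_l(x) dx`. [folklore] -/
abbrev CKey := ZVec4 × ℕ × ℕ

/-- Canonical key of `(d, k, l)` under `(d, k, l) ∼ (−d, l, k)` (and `(0, k, l) ∼ (0, l, k)`). [folklore] -/
def ckey (d : ZVec4) (k l : ℕ) : CKey :=
  if d = (0, 0, 0, 0) then (d, min k l, max k l)
  else if canon d = d then (d, k, l) else (canon d, l, k)

/-- **The certificate data** (see `JointSOS.Cert`; new fields: `pcells`, the cell index in `mc`, `g0`). [folklore] -/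
structure Cert where
  /-- the four primes (torus coordinates) -/
  p : ℕ × ℕ × ℕ × ℕ
  /-- range hints `2^{e_j} ≤ p_j ≤ 2^{e_j+1}` (checked) -/
  e : ℕ × ℕ × ℕ × ℕ
  /-- window items `(j, e)`: the prime power `p_j^e` -/
  window : List (ℕ × ℕ)
  /-- number of cells `p ≥ 1` (cell width `2·aQ/p`) -/
  pcells : ℕ
  /-- the Gram data: (monomial exponent vector `S_β`, cell `k < pcells`, Gram vector `c ∈ ℤ^r`) -/
  mc : List (ZVec4 × ℕ × List ℤ)
  /-- scaling: `Q = (⟨c_i, c_{i'}⟩)/4^kbits` -/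
  kbits : ℕ
  /-- fixed-point precision `P` (bits) of the logarithm enclosures -/
  prec : ℕ
  /-- number of series terms `K` of the logarithm enclosures -/
  terms : ℕ
  /-- CLAIMED lower enclosures `⌊2^P log p_j⌋` (checked against `FixedPoint.logNatLo`) -/
  llo : ℕ × ℕ × ℕ × ℕ
  /-- CLAIMED upper enclosures of `2^P log p_j` (checked against `FixedPoint.logNatHi`) -/
  lhi : ℕ × ℕ × ℕ × ℕ
  /-- CLAIMED `⌊2^P √(p_j^e)⌋` for each window item, same order (checked by squaring) -/
  wsq : List ℕ
  /-- validity: the window half-width `aQ` (the bound then holds for every `a ≤ aQ`) -/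
  aQ : ℚ
  /-- CLAIMED integer threshold `2^{P+1} · num(aQ)` (checked) -/
  thr : ℤ
  /-- CLAIMED denominator of `aQ` (checked) -/
  aden : ℤ
  /-- number of class parts -/
  nparts : ℕ
  /-- CLAIMED bound of the non-zero classes of each part -/
  dparts : List ℚ
  /-- CLAIMED bound of every zero-class mass `g(0,k,k)` -/
  g0 : ℚ
  /-- the claimed constant (`g0 + Σ dparts ≤ D`, checked) -/
  D : ℚ

namespace Cert

variable (c : Cert)

/-- The underlying K2 header (primes, hints, enclosures, window): lets us REUSE every `JointSOS.Cert` function and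
bracket lemma that does not look at the Gram data. [folklore] -/
def toJ : JointSOS.Cert where
  p := c.p
  e := c.e
  window := c.window
  mc := []
  kbits := c.kbits
  prec := c.prec
  terms := c.terms
  llo := c.llo
  lhi := c.lhi
  wsq := c.wsq
  aQ := c.aQ
  thr := c.thr
  aden := c.aden
  nparts := 1
  dparts := []
  D := 0

/-- The ADMISSIBILITY test of the class `(γ, k, l)`: `γ = 0 ∧ k ≠ l` (disjoint cells), or certified
`γ·ℓ > 2h(l−k+1)` or `γ·ℓ < 2h(l−k−1)`, `2h = 2aQ/p` (integer form with the enclosures of `2^P γ·ℓ`). [folklore] -/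
def adm (γ : ZVec4) (k l : ℕ) : Bool :=
  (decide (γ = (0, 0, 0, 0)) && !decide (k = l)) ||
  decide (c.thr * ((l : ℤ) - k + 1) < c.toJ.freqLo γ * c.aden * c.pcells) ||
  decide (c.toJ.freqHi γ * c.aden * c.pcells < c.thr * ((l : ℤ) - k - 1))

/-- An entry of a class table: key, accumulated integer Gram mass, attached window items. -/
abbrev Entry := CKey × ℤ × List WItem

/-- Accumulate into the class table (linear search on the key). [folklore] -/
def ins (κ : CKey) (v : ℤ) (ws : List WItem) : List Entry → List Entry
  | [] => [(κ, v, ws)]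
  | (κ', v', ws') :: rest =>
      if κ = κ' then (κ', v' + v, ws ++ ws') :: rest else (κ', v', ws') :: ins κ v ws rest

/-- The part of a key: first coordinate of `γ` modulo `nparts`. [folklore] -/
def partOf (κ : CKey) : ℕ := κ.1.1.natAbs % c.nparts

/-- One step of the pair pass in part `j`: the pair (`α` in cell `kα`, a later `β` in cell `sc.2.1`), both
orientations at once (factor `2`), class `ckey (S_β − S_α) l kα`; skipped if admissible or in another part. -/
def step (j : ℕ) (sα : ZVec4) (kα : ℕ) (cα : List ℤ) (sc : ZVec4 × ℕ × List ℤ) (acc : List Entry) :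
    List Entry :=
  if c.adm (ckey (vsub sc.1 sα) sc.2.1 kα).1 (ckey (vsub sc.1 sα) sc.2.1 kα).2.1
      (ckey (vsub sc.1 sα) sc.2.1 kα).2.2 then acc else
    if c.partOf (ckey (vsub sc.1 sα) sc.2.1 kα) = j then
      ins (ckey (vsub sc.1 sα) sc.2.1 kα) (2 * dotZ cα sc.2.2) [] acc else acc

/-- Inner pass over the later Gram entries. -/
def innerPass (j : ℕ) (sα : ZVec4) (kα : ℕ) (cα : List ℤ) :
    List (ZVec4 × ℕ × List ℤ) → List Entry → List Entry
  | [], acc => acc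
  | sc :: rest, acc =>
      match c.step j sα kα cα sc acc with
      | [] => innerPass j sα kα cα rest []
      | en :: es => innerPass j sα kα cα rest (en :: es)

/-- Outer pass over the UPPER triangle `α < β` only: the diagonal `(α, α)` (zero classes `(0,k,k)`, value
`‖f_k‖²`) is accounted for separately by the per-cell masses `massOf` against `g0` (see `check`). -/
def outerPass (j : ℕ) : List (ZVec4 × ℕ × List ℤ) → List Entry → List Entry
  | [], acc => acc
  | sa :: rest, acc =>
      match c.innerPass j sa.1 sa.2.1 sa.2.2 rest acc with
      | [] => outerPass j rest []
      | en :: es => outerPass j rest (en :: es)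

/-- The diagonal Gram mass of cell `k`: `Σ_{α in cell k} |c_α|²`. [folklore] -/
def massOf (k : ℕ) : List (ZVec4 × ℕ × List ℤ) → ℤ
  | [] => 0
  | sa :: rest => (if sa.2.1 = k then dotZ sa.2.2 sa.2.2 else 0) + massOf k rest

/-- Every cell's diagonal mass is `≤ g0 · 4^kbits`. -/
def massOK : List ℕ → Bool
  | [] => true
  | k :: ks => decide ((massOf k c.mc : ℚ) ≤ c.g0 * (4 : ℚ) ^ c.kbits) && massOK ks

/-- Window entries of part `j` for item `w` and first cell `k`, over the second cells `l ∈ L`: for each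
NON-admissible class `(e·unit j', k, l)` of part `j` the synthetic entry `((e·unit j', k, l), 0, [w])`
(the class `J_{kl}(e log p_{j'})`, weight `2·(log p/√p^e)`). -/
def windowRow (j : ℕ) (w : WItem) (k : ℕ) : List ℕ → List Entry → List Entry
  | [], acc => acc
  | l :: rest, acc =>
      windowRow j w k rest
        (if !c.adm (uvec w.1 w.2.1) k l && decide (c.partOf (uvec w.1 w.2.1, k, l) = j)
         then ins (uvec w.1 w.2.1, k, l) 0 [w] acc else acc)

/-- Window entries of part `j` for item `w`, over the first cells `k ∈ K` (second cells: all `l < p`). -/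
def windowCells (j : ℕ) (w : WItem) : List ℕ → List Entry → List Entry
  | [], acc => acc
  | k :: rest, acc => windowCells j w rest (c.windowRow j w k (List.range c.pcells) acc)

/-- Window entries of part `j` (all items, all cell pairs). -/
def windowEntries (j : ℕ) : List WItem → List Entry → List Entry
  | [], acc => acc
  | w :: rest, acc => windowEntries j rest (c.windowCells j w (List.range c.pcells) acc)

/-- The class table of part `j`. [folklore] -/
def table (j : ℕ) : List Entry := c.outerPass j c.mc (c.windowEntries j c.toJ.witems [])

/-- Certified bound of one entry: `max |2·wLo/Hi-sum + v/4^k|` (valid for every class since `|X| ≤ ∫ f²`). -/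
def entryBound (en : Entry) : ℚ :=
  max |2 * c.toJ.wLoSum en.2.2 + (en.2.1 : ℚ) / (4 : ℚ) ^ c.kbits|
    |2 * c.toJ.wHiSum en.2.2 + (en.2.1 : ℚ) / (4 : ℚ) ^ c.kbits|

/-- Plain sum of the entry bounds (specification of the accumulator). -/
def tableBound : List Entry → ℚ
  | [] => 0
  | en :: rest => c.entryBound en + tableBound rest

/-- One pass over a table: attached items well formed and accumulated bound `≤ bound`. -/
def tableCheck (bound : ℚ) : List Entry → ℚ → Bool
  | [], acc => decide (acc ≤ bound)
  | en :: rest, acc => c.toJ.attachedOK en.2.2 && tableCheck bound rest (acc + c.entryBound en)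

/-- **Part check**. -/
def checkPart (j : ℕ) : Bool := c.tableCheck (c.dparts.getD j 0) (c.table j) 0

/-- All Gram vectors have length `r` and all cells are `< pcells`. -/
def colsOK (r : ℕ) : List (ZVec4 × ℕ × List ℤ) → Bool
  | [] => true
  | sc :: rest => decide (sc.2.2.length = r) && decide (sc.2.1 < c.pcells) && colsOK r rest

/-- The common length of the Gram vectors. -/
def rank : ℕ := ((c.mc.headD ((0, 0, 0, 0), 0, [])).2.2).length

/-- **The main (cheap) check**. [folklore] -/
def check : Bool :=
  c.toJ.hintsOK && c.toJ.logsOK && decide (c.window.length = c.wsq.length) && c.toJ.windowOK c.toJ.witems &&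
    c.colsOK c.rank c.mc && decide (0 < c.aden) && decide (0 < c.nparts) && decide (0 < c.pcells) &&
    decide (c.dparts.length = c.nparts) && decide (0 ≤ c.g0) && c.massOK (List.range c.pcells) &&
    decide (c.g0 + JointSOS.Cert.qsum c.dparts ≤ c.D)

variable {c}

/-! ### Unpacking the structural checks -/

/-- `colsOK_spec`. [folklore] -/
theorem colsOK_spec {r : ℕ} : ∀ {l : List (ZVec4 × ℕ × List ℤ)}, c.colsOK r l = true →
    ∀ sc ∈ l, sc.2.2.length = r ∧ sc.2.1 < c.pcells
  | [], _ => by simp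
  | sc :: rest, h => by
      simp only [colsOK, Bool.and_eq_true, decide_eq_true_eq] at h
      intro x hx
      rcases List.mem_cons.1 hx with rfl | hx
      · exact ⟨h.1.1, h.1.2⟩
      · exact colsOK_spec h.2 x hx

/-- `massOK_spec`. [folklore] -/
theorem massOK_spec : ∀ {l : List ℕ}, c.massOK l = true → ∀ k ∈ l, (massOf k c.mc : ℚ) ≤ c.g0 * (4 : ℚ) ^ c.kbits
  | [], _ => by simp
  | k :: ks, h => by
      simp only [massOK, Bool.and_eq_true, decide_eq_true_eq] at h
      intro x hx
      rcases List.mem_cons.1 hx with rfl | hx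
      · exact h.1
      · exact massOK_spec h.2 x hx

/-- `tableCheck_spec`. [folklore] -/
theorem tableCheck_spec {bound : ℚ} : ∀ {L : List Entry} {acc : ℚ}, c.tableCheck bound L acc = true →
    (∀ en ∈ L, ∀ w ∈ en.2.2, c.toJ.witemOK w = true) ∧ acc + c.tableBound L ≤ bound
  | [], acc, h => by
      simp only [tableCheck, decide_eq_true_eq] at h
      exact ⟨by simp, by simpa [tableBound] using h⟩
  | en :: rest, acc, h => by
      simp only [tableCheck, Bool.and_eq_true] at h
      obtain ⟨h1, h2⟩ := h
      obtain ⟨ih1, ih2⟩ := tableCheck_spec h2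
      refine ⟨fun x hx ↦ ?_, ?_⟩
      · rcases List.mem_cons.1 hx with rfl | hx
        · exact JointSOS.Cert.attachedOK_spec h1
        · exact ih1 x hx
      · simp only [tableBound]; linarith

end Cert

end CellSOS

end Summit.RiemannHypothesis.RiemannHypothesis.Theorems.WeilFormatC
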